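import Mathlib.GroupTheory.QuotientGroup.Basic
import Mathlib.GroupTheory.Index
import Mathlib.Data.ZMod.QuotientGroup
import Mathlib.Algebra.Module.Torsion.Basic
import HarnessLib

/-!
# The STABILISED dual side of the count (C) as pure algebra: purity of a cyclic subgroup of maximal
# exponent, `R = ℤg + R[t]`, and the index `[R : ker(t·φ)] = ord(φ g)/t` (cell `b2b-bsdres`,
# CLASS-CLOSURE lane, class O10 — x1b GEN 37, class lead; file 60 of the series: brick B6 of the
# global count (C) at FINITE level, with its arithmetic inputs displayed as hypotheses)

HONEST FRAMING (cell `b2b-bsdres`, run/shared/lean/b2b/bsd-rank1-residual/, verbatim in every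
file): the goal of the cell is to DELETE the COMBINATION-SHAPED residual classes of the
Birch–Swinnerton-Dyer formula for ALL analytic-rank `≤ 1` elliptic curves over `ℚ` — "full BSD
formula for every rank `≤ 1` curve in class `C`" assembled STRICTLY from published theorems — so
that the rank-`≤ 1` remainder becomes exactly the CONSTRUCTION-SHAPED classes, which are TYPED
(missing-input `Prop`s), NOT attempted. This is not "finishing BSD". CLASS-CLOSURE lane: prove
what is provable now; shrink each hard class to its core with data; no claim beyond stated classes;
research routes on CONSTRUCTION-SHAPED X12 / O10; census / instrument output = EVIDENCE / conjecture
items, NEVER a Literature fact; `RESIDUAL-MAP.md` marks change only by signed lines. THIS FILE: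
TOOL THEOREMS ONLY (abelian-group bookkeeping) — no definition, no named Literature fact, no
Summits-side fact `def … : Prop`, no `sorry`, axioms standard; nothing is booked; no label / mark /
count / sub-cell moves; (C1_η), (C2_η-GZ), (C3_η) stay typed as filed (cc-typer-6's pen); O10 stays
OPEN / CONSTRUCTION-SHAPED; nothing about `BSD(W, p)` of any pair is claimed.

## What (x1b GEN 36 `TWIST-HYPOTHESES-DISCHARGED-x1b.md` §2, "the level-`n` dictionary for (C)")

With bricks B1, B2, B4, B5 (product form, file 58) and B7 (file 56) in the kernel, the count (C)
`#(A₀ ⧸ S₀) = p^ν · Tam(W)^{(p)}` is, at finite level `p^m`, the DUAL-SIDE index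
`[H¹_{𝓕^*}(ℚ, W[p^m]) : H¹_{𝓖^*}(ℚ, W[p^m])]`, where `H¹_{𝓕^*} = R_m := Sel^{rel @ p}_{p^m}(W/ℚ)` (Kummer
away from `p`, no condition at `p`) and `H¹_{𝓖^*} = {c ∈ R_m | p^t·loc_p c ∈ C_m^⊥, loc_ℓ c ∈ 𝒦_{m,ℓ}^⊥}`
once the level-`∞` condition at `p` is cut to `C_m[p^n] = p^t C_m` (`m = n + t`; harmless since `A₀`
is finite of known order, file 59). The T_p-adic input "`lim← R_m = ℤ_p κ(P)`" (B6) becomes, at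
finite level, the STABILISATION `p^t R_m = p^t ℤκ_m(P)` for `t ≥ ν + e` — a consequence of three
arithmetic facts: `R_m` has exponent `p^m`; `κ_m(P)` has order exactly `p^m` (`W(ℚ)/p^m = ℤ/p^m · P`);
`p^{ν+e} R_m ⊆ ℤκ_m(P)` (`[R_m : Sel_{p^m}] ∣ p^ν` by the exact relaxation index, `p^e Sel_{p^m} ⊆ ℤκ_m(P)`
by `p^e Ш(W)[p^∞] = 0`). THIS FILE is the pure algebra turning these inputs into the dual-side index:

* §1 `exists_nsmul_eq_nsmul_zsmul_of_nsmul_mem_zmultiples` — PURITY of a cyclic subgroup of maximal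
  exponent: if `N·R = 0`, `ord g = N`, `d ∣ N` and `d·x ∈ ℤg` then `d·x ∈ d·ℤg`;
  `exists_nsmul_eq_nsmul_zsmul` — STABILISATION: if moreover `k·R ⊆ ℤg` and `k ∣ t ∣ N` then
  `t·x ∈ t·ℤg` for every `x`; `exists_eq_zsmul_add_of_nsmul` / `zmultiples_sup_torsionBy_eq_top` —
  hence **`R = ℤg + R[t]`**.
* §2 for `φ : R →+ Q` with `t ∣ ord(φ g)`, `c := ord(φ g)/t`: `mem_ker_nsmul_iff`,
  **`ker_nsmul_eq`: `ker(t·φ) = ℤ(c·g) + R[t]`**; `range_nsmul_eq`: `im(t·φ) = ℤ(t·φ g)`;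
  **`index_ker_nsmul_eq`: `[R : ker(t·φ)] = c`**; `apply_mem_of_mem_ker_nsmul` /
  `ker_nsmul_inf_iInf_comap_eq` / `index_ker_nsmul_inf_iInf_comap_eq` — any further local conditions
  `ψ_i c ∈ D_i` that hold on `R[t]` and at `c·g` are IDLE on `ker(t·φ)`, so the dual Selmer group
  `ker(t·φ) ⊓ ⨅_i ψ_i⁻¹ D_i` still has index `c`.
* §3 the order inputs: `addOrderOf_mk_eq_of_inf_eq_bot` (`ord(q mod D) = ord q` for `q ∈ L`,
  `L ⊓ D = ⊥` — the Kummer line is transverse to `C_m^⊥`) and `addOrderOf_mul_nsmul_eq_div`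
  (`ord((p^ν u)·q) = ord q / p^ν` for `p ∤ u`); §4 `index_eq_prime_pow` — the prime-power numerology:
  `p^m R = 0`, `ord g = p^m`, `p^k R ⊆ ℤg`, `ord(φ g) = p^{m−ν}`, `k ≤ t`, `t + ν ≤ m` ⟹
  **`[R : ker(p^t·φ) ⊓ ⨅_i ψ_i⁻¹ D_i] = p^{m−t−ν} = p^{n−ν}`** — the value file 58 needs
  (`[H¹_{𝓕^*} : H¹_{𝓖^*}] = p^{n−ν}` ⟹ `#(A₀ ⧸ S₀) · p^{n−ν} = p^n · Tam(W)^{(p)}`).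

NOT here (the arithmetic inputs, for the successor files): `R_m = Sel^{rel@p}_{p^m}` has exponent
`p^m`; `ord κ_m(P) = p^m`; `p^{ν+e} R_m ⊆ ℤκ_m(P)` (X11b `KummerRelaxationIndexExact` + `Ш`-exponent);
`ord(loc_p κ_m(P) mod C_m^⊥) = p^{m−ν}` (Kummer line `⟨κ_m(Q)⟩` of order `p^m` transverse to `C_m^⊥`,
`loc_p κ(P) = p^ν u κ(Q)`); `loc_ℓ(R_m[p^t]) = 0 = loc_ℓ(p^{n−ν} κ_m(P))` for `n − ν ≥ exp_p W(ℚ_ℓ)[p^∞]`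
(`R_m[p^t] = ι_* R_t`, `ι_* κ_t = κ_m ∘ p^{m−t}`); B3 (`#C_m = p^m`).

References: [GreenbergLNM1716] R. Greenberg, LNM 1716 (1999), §4 (proof of Thm. 4.1, pp. 98–103:
the Cassels–Poitou–Tate count against the compact Selmer group `H¹_f(ℚ, T_p E)`); [MilneADT2006]
I Thm. 4.10, §6 proof of Prop. 6.9 (the level-change maps `A_m → A_{m²}`, `m : A_{m²} → A_m`);
[Kobayashi2003] Thm. 6.2 (p. 11), Thm. 9.3 (p. 26).
-/

namespace Summit.BirchSwinnertonDyer.Rank1Residual.Additive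

namespace StabilisedDual

open AddSubgroup

/-! ## §1 Purity of a cyclic subgroup of maximal exponent; `R = ℤg + R[t]` -/

section Purity

variable {R : Type*} [AddCommGroup R] {N : ℕ} {g : R}

/-- **Purity of a cyclic subgroup of maximal exponent.** If `N • R = 0`, `g` has order exactly `N ≠ 0`,
`d ∣ N` and `d • x ∈ ℤg`, then `d • x = d • (b • g)` for some `b : ℤ` (write `d • x = a • g`; then
`(N/d)·a • g = N • x = 0`, so `N ∣ (N/d)·a`, i.e. `d ∣ a`). In (C): `R = R_m = Sel^{rel@p}_{p^m}(W/ℚ)`,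
`N = p^m`, `g = κ_m(P)`. [folklore] -/
theorem exists_nsmul_eq_nsmul_zsmul_of_nsmul_mem_zmultiples (hN : N ≠ 0) (hR : ∀ x : R, N • x = 0)
    (hg : addOrderOf g = N) {d : ℕ} (hd : d ∣ N) {x : R} (hx : d • x ∈ zmultiples g) :
    ∃ b : ℤ, d • x = d • (b • g) := by
  obtain ⟨a, ha⟩ := mem_zmultiples_iff.mp hx
  obtain ⟨e, he⟩ := hd
  have he0 : e ≠ 0 := by rintro rfl; exact hN (by rw [he, mul_zero])
  -- `(e * a) • g = e • (d • x) = N • x = 0`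
  have h0 : ((e : ℤ) * a) • g = 0 := by
    rw [mul_zsmul, ha, natCast_zsmul, ← mul_nsmul', mul_comm, ← he]
    exact hR x
  -- hence `N ∣ e * a`, i.e. `d ∣ a`
  have hdvd : (N : ℤ) ∣ (e : ℤ) * a := by
    rw [← hg]; exact (addOrderOf_dvd_iff_zsmul_eq_zero).mpr h0
  rw [he, Nat.cast_mul, mul_comm (d : ℤ)] at hdvd
  obtain ⟨b, hb⟩ := Int.dvd_of_mul_dvd_mul_left (by exact_mod_cast he0) hdvd
  refine ⟨b, ?_⟩
  rw [← ha, hb, mul_zsmul, natCast_zsmul]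

/-- **Stabilisation.** If `N • R = 0`, `ord g = N ≠ 0`, `k • R ⊆ ℤg` and `k ∣ t ∣ N`, then for every
`x` there is `b : ℤ` with `t • x = t • (b • g)` — i.e. **`t·R = t·ℤg`**: the finite-level form of
"`lim←_m Sel^{rel@p}_{p^m}(W) = ℤ_p κ(P)`" (`k = p^{ν+e}`: `p^ν` from the relaxation index at `p`,
`p^e` the exponent of `Ш(W)[p^∞]`). [cite: GreenbergLNM1716, §4 (pp. 98–103)] -/
theorem exists_nsmul_eq_nsmul_zsmul (hN : N ≠ 0) (hR : ∀ x : R, N • x = 0) (hg : addOrderOf g = N)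
    {k t : ℕ} (hk : ∀ x : R, k • x ∈ zmultiples g) (hkt : k ∣ t) (ht : t ∣ N) (x : R) :
    ∃ b : ℤ, t • x = t • (b • g) := by
  refine exists_nsmul_eq_nsmul_zsmul_of_nsmul_mem_zmultiples hN hR hg ht ?_
  obtain ⟨s, rfl⟩ := hkt
  rw [mul_comm, mul_nsmul']
  exact AddSubgroup.nsmul_mem _ (hk x) s

/-- **`R = ℤg + R[t]`** (elementwise): under the hypotheses of `exists_nsmul_eq_nsmul_zsmul`, every `x`
is `b • g + y` with `t • y = 0`. [folklore] -/
theorem exists_eq_zsmul_add_of_nsmul (hN : N ≠ 0) (hR : ∀ x : R, N • x = 0) (hg : addOrderOf g = N)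
    {k t : ℕ} (hk : ∀ x : R, k • x ∈ zmultiples g) (hkt : k ∣ t) (ht : t ∣ N) (x : R) :
    ∃ b : ℤ, ∃ y : R, t • y = 0 ∧ x = b • g + y := by
  obtain ⟨b, hb⟩ := exists_nsmul_eq_nsmul_zsmul hN hR hg hk hkt ht x
  exact ⟨b, x - b • g, by rw [nsmul_sub, hb, sub_self], by rw [add_sub_cancel]⟩

/-- **`R = ℤg + R[t]`** (as subgroups): `ℤg ⊔ R[t] = ⊤`. [folklore] -/
theorem zmultiples_sup_torsionBy_eq_top (hN : N ≠ 0) (hR : ∀ x : R, N • x = 0)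
    (hg : addOrderOf g = N) {k t : ℕ} (hk : ∀ x : R, k • x ∈ zmultiples g) (hkt : k ∣ t)
    (ht : t ∣ N) : zmultiples g ⊔ torsionBy R t = ⊤ := by
  rw [eq_top_iff]
  intro x _
  obtain ⟨b, y, hy, rfl⟩ := exists_eq_zsmul_add_of_nsmul hN hR hg hk hkt ht x
  exact AddSubgroup.add_mem_sup (mem_zmultiples_iff.mpr ⟨b, rfl⟩) (torsionBy.nsmul_iff.mpr hy)

end Purity

/-! ## §2 The stabilised dual-side kernel `ker(t·φ)` and its index -/

section Kernel

variable {R Q : Type*} [AddCommGroup R] [AddCommGroup Q] {N : ℕ} {g : R} (φ : R →+ Q)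

/-- Membership in the stabilised dual Selmer condition: under `N • R = 0`, `ord g = N ≠ 0`,
`k • R ⊆ ℤg`, `k ∣ t ∣ N` and `t ∣ ord(φ g)`, with `c = ord(φ g) / t`:
**`t • φ x = 0 ↔ x ∈ ℤ(c • g) + R[t]`.** (`⊇`: `t • φ(c • g) = ord(φ g) • φ g = 0`; `⊆`: `x = b • g + y`,
`t • φ x = (t b) • φ g = 0` forces `ord(φ g) ∣ t b`, i.e. `c ∣ b`.) In (C): `φ = loc_p mod C_m^⊥`,
`t = p^t`, `ord(φ g) = p^{m−ν}`, `c = p^{n−ν}`. [cite: GreenbergLNM1716, §4 (pp. 98–103)] -/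
theorem mem_ker_nsmul_iff (hN : N ≠ 0) (hR : ∀ x : R, N • x = 0) (hg : addOrderOf g = N)
    {k t : ℕ} (hk : ∀ x : R, k • x ∈ zmultiples g) (hkt : k ∣ t) (ht : t ∣ N)
    (hφ : t ∣ addOrderOf (φ g)) (x : R) :
    x ∈ (t • φ).ker ↔ x ∈ zmultiples ((addOrderOf (φ g) / t) • g) ⊔ torsionBy R t := by
  set c := addOrderOf (φ g) / t with hc
  have ht0 : t ≠ 0 := by rintro rfl; exact hN (Nat.eq_zero_of_zero_dvd ht)
  have htc : t * c = addOrderOf (φ g) := Nat.mul_div_cancel' hφ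
  constructor
  · intro hx
    rw [AddMonoidHom.mem_ker, AddMonoidHom.nsmul_apply] at hx
    obtain ⟨b, y, hy, rfl⟩ := exists_eq_zsmul_add_of_nsmul hN hR hg hk hkt ht x
    -- `t • φ (b • g + y) = (t * b) • φ g`
    have hy' : t • φ y = 0 := by rw [← map_nsmul φ t y, hy, map_zero]
    have h1 : t • φ (b • g + y) = ((t : ℤ) * b) • φ g := by
      rw [map_add, nsmul_add, hy', add_zero, map_zsmul, mul_zsmul, natCast_zsmul]
    rw [h1] at hx
    have hdvd : (addOrderOf (φ g) : ℤ) ∣ (t : ℤ) * b := (addOrderOf_dvd_iff_zsmul_eq_zero).mpr hx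
    rw [← htc, Nat.cast_mul] at hdvd
    obtain ⟨b', hb'⟩ := Int.dvd_of_mul_dvd_mul_left (by exact_mod_cast ht0) hdvd
    refine AddSubgroup.add_mem_sup (mem_zmultiples_iff.mpr ⟨b', ?_⟩) (torsionBy.nsmul_iff.mpr hy)
    rw [hb', mul_comm, mul_zsmul, natCast_zsmul]
  · intro hx
    rw [AddMonoidHom.mem_ker, AddMonoidHom.nsmul_apply]
    obtain ⟨z, hz, y, hy, rfl⟩ := AddSubgroup.mem_sup.mp hx
    obtain ⟨b, rfl⟩ := mem_zmultiples_iff.mp hz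
    rw [torsionBy.nsmul_iff] at hy
    have hy' : t • φ y = 0 := by rw [← map_nsmul φ t y, hy, map_zero]
    rw [map_add, nsmul_add, hy', add_zero, map_zsmul, map_nsmul, smul_comm t b, ← mul_nsmul', htc,
      addOrderOf_nsmul_eq_zero, zsmul_zero]

/-- **`ker(t·φ) = ℤ(c·g) + R[t]`**, `c = ord(φ g)/t` (subgroup form of `mem_ker_nsmul_iff`).
[cite: GreenbergLNM1716, §4 (pp. 98–103)] -/
theorem ker_nsmul_eq (hN : N ≠ 0) (hR : ∀ x : R, N • x = 0) (hg : addOrderOf g = N)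
    {k t : ℕ} (hk : ∀ x : R, k • x ∈ zmultiples g) (hkt : k ∣ t) (ht : t ∣ N)
    (hφ : t ∣ addOrderOf (φ g)) :
    (t • φ).ker = zmultiples ((addOrderOf (φ g) / t) • g) ⊔ torsionBy R t :=
  AddSubgroup.ext (mem_ker_nsmul_iff φ hN hR hg hk hkt ht hφ)

/-- **`im(t·φ) = ℤ(t • φ g)`**: since `R = ℤg + R[t]` and `t·φ` kills `R[t]`. [folklore] -/
theorem range_nsmul_eq (hN : N ≠ 0) (hR : ∀ x : R, N • x = 0) (hg : addOrderOf g = N)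
    {k t : ℕ} (hk : ∀ x : R, k • x ∈ zmultiples g) (hkt : k ∣ t) (ht : t ∣ N) :
    (t • φ).range = zmultiples (t • φ g) := by
  ext q
  constructor
  · rintro ⟨x, rfl⟩
    obtain ⟨b, y, hy, rfl⟩ := exists_eq_zsmul_add_of_nsmul hN hR hg hk hkt ht x
    refine mem_zmultiples_iff.mpr ⟨b, ?_⟩
    have hy' : t • φ y = 0 := by rw [← map_nsmul φ t y, hy, map_zero]
    rw [AddMonoidHom.nsmul_apply, map_add, nsmul_add, hy', add_zero, map_zsmul]
    exact smul_comm _ _ _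
  · intro hq
    obtain ⟨b, rfl⟩ := mem_zmultiples_iff.mp hq
    refine ⟨b • g, ?_⟩
    rw [AddMonoidHom.nsmul_apply, map_zsmul]
    exact smul_comm _ _ _

/-- **The stabilised dual-side index `[R : ker(t·φ)] = ord(φ g) / t`.** (`[R : ker] = #im = #ℤ(t • φ g)
= ord(t • φ g) = ord(φ g)/t` as `t ∣ ord(φ g)`.) In (C) this is `[R_m : H¹_{𝓖^*}] = p^{m−ν}/p^t = p^{n−ν}`.
[cite: GreenbergLNM1716, §4 (pp. 98–103)] -/
theorem index_ker_nsmul_eq (hN : N ≠ 0) (hR : ∀ x : R, N • x = 0) (hg : addOrderOf g = N)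
    {k t : ℕ} (hk : ∀ x : R, k • x ∈ zmultiples g) (hkt : k ∣ t) (ht : t ∣ N)
    (hφ : t ∣ addOrderOf (φ g)) :
    (t • φ).ker.index = addOrderOf (φ g) / t := by
  have ht0 : t ≠ 0 := by rintro rfl; exact hN (Nat.eq_zero_of_zero_dvd ht)
  rw [AddSubgroup.index_ker, range_nsmul_eq φ hN hR hg hk hkt ht, Nat.card_zmultiples,
    addOrderOf_nsmul_of_dvd ht0 hφ]

/-- **Further local conditions are idle on `ker(t·φ)`.** If `ψ : R →+ Q'` sends `R[t]` into `D` and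
`ψ (c • g) ∈ D` (`c = ord(φ g)/t`), then `ψ x ∈ D` for every `x ∈ ker(t·φ)` — in (C): the conditions
`loc_ℓ c ∈ 𝒦_{m,ℓ}^⊥` at `ℓ ≠ p` hold on `ker(p^t · (loc_p mod C_m^⊥))` because `loc_ℓ` VANISHES on
`R_m[p^t] = ι_* R_t` and at `p^{n−ν} κ_m(P)` once `n − ν ≥ exp_p W(ℚ_ℓ)[p^∞]`. [folklore] -/
theorem apply_mem_of_mem_ker_nsmul (hN : N ≠ 0) (hR : ∀ x : R, N • x = 0) (hg : addOrderOf g = N)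
    {k t : ℕ} (hk : ∀ x : R, k • x ∈ zmultiples g) (hkt : k ∣ t) (ht : t ∣ N)
    (hφ : t ∣ addOrderOf (φ g)) {Q' : Type*} [AddCommGroup Q'] (ψ : R →+ Q') (D : AddSubgroup Q')
    (hψt : ∀ y : R, t • y = 0 → ψ y ∈ D) (hψg : ψ ((addOrderOf (φ g) / t) • g) ∈ D)
    {x : R} (hx : x ∈ (t • φ).ker) : ψ x ∈ D := by
  rw [mem_ker_nsmul_iff φ hN hR hg hk hkt ht hφ] at hx
  obtain ⟨z, hz, y, hy, rfl⟩ := AddSubgroup.mem_sup.mp hx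
  obtain ⟨b, rfl⟩ := mem_zmultiples_iff.mp hz
  rw [torsionBy.nsmul_iff] at hy
  rw [map_add, map_zsmul]
  exact D.add_mem (D.zsmul_mem hψg b) (hψt y hy)

variable {ι : Type*} {Q' : ι → Type*} [∀ i, AddCommGroup (Q' i)] (ψ : ∀ i, R →+ Q' i)
  (D : ∀ i, AddSubgroup (Q' i))

/-- **The dual Selmer group IS `ker(t·φ)`**: `ker(t·φ) ⊓ ⨅_i ψ_i⁻¹(D_i) = ker(t·φ)` when every `ψ_i` sends
`R[t]` and `c • g` into `D_i`. [folklore] -/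
theorem ker_nsmul_inf_iInf_comap_eq (hN : N ≠ 0) (hR : ∀ x : R, N • x = 0) (hg : addOrderOf g = N)
    {k t : ℕ} (hk : ∀ x : R, k • x ∈ zmultiples g) (hkt : k ∣ t) (ht : t ∣ N)
    (hφ : t ∣ addOrderOf (φ g)) (hψt : ∀ i, ∀ y : R, t • y = 0 → ψ i y ∈ D i)
    (hψg : ∀ i, ψ i ((addOrderOf (φ g) / t) • g) ∈ D i) :
    (t • φ).ker ⊓ ⨅ i, (D i).comap (ψ i) = (t • φ).ker := by
  refine le_antisymm inf_le_left (le_inf le_rfl ?_)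
  intro x hx
  rw [AddSubgroup.mem_iInf]
  intro i
  rw [AddSubgroup.mem_comap]
  exact apply_mem_of_mem_ker_nsmul φ hN hR hg hk hkt ht hφ (ψ i) (D i) (hψt i) (hψg i) hx

/-- **`[R : ker(t·φ) ⊓ ⨅_i ψ_i⁻¹(D_i)] = ord(φ g) / t`** under the hypotheses of
`ker_nsmul_inf_iInf_comap_eq`. [cite: GreenbergLNM1716, §4 (pp. 98–103)] -/
theorem index_ker_nsmul_inf_iInf_comap_eq (hN : N ≠ 0) (hR : ∀ x : R, N • x = 0)
    (hg : addOrderOf g = N) {k t : ℕ} (hk : ∀ x : R, k • x ∈ zmultiples g) (hkt : k ∣ t)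
    (ht : t ∣ N) (hφ : t ∣ addOrderOf (φ g)) (hψt : ∀ i, ∀ y : R, t • y = 0 → ψ i y ∈ D i)
    (hψg : ∀ i, ψ i ((addOrderOf (φ g) / t) • g) ∈ D i) :
    ((t • φ).ker ⊓ ⨅ i, (D i).comap (ψ i)).index = addOrderOf (φ g) / t := by
  rw [ker_nsmul_inf_iInf_comap_eq φ ψ D hN hR hg hk hkt ht hφ hψt hψg,
    index_ker_nsmul_eq φ hN hR hg hk hkt ht hφ]

end Kernel

/-! ## §3 The two order inputs at `p` -/

section Orders

variable {H : Type*} [AddCommGroup H]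

/-- **Transversality preserves orders in the quotient**: if `L ⊓ D = ⊥` and `q ∈ L` then the class of
`q` in `H ⧸ D` has the same order as `q` (the quotient map is injective on `L`). In (C): `L` the Kummer
line `⟨κ_m(Q)⟩ ≤ H¹(ℚ_p, W[p^m])`, `D = C_m^⊥`, `L ⊓ C_m^⊥ = (L + C_m)^⊥ = 0`. [folklore] -/
theorem addOrderOf_mk_eq_of_inf_eq_bot (L D : AddSubgroup H) (hLD : L ⊓ D = ⊥) {q : H} (hq : q ∈ L) :
    addOrderOf (QuotientAddGroup.mk' D q) = addOrderOf q := by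
  have hinj : Function.Injective ((QuotientAddGroup.mk' D).comp L.subtype) := by
    intro a b hab
    rw [AddMonoidHom.comp_apply, AddMonoidHom.comp_apply, L.subtype_apply, L.subtype_apply,
      QuotientAddGroup.mk'_apply, QuotientAddGroup.mk'_apply, QuotientAddGroup.eq] at hab
    have hmem : -(a : H) + b ∈ L ⊓ D := ⟨L.add_mem (L.neg_mem a.2) b.2, hab⟩
    rw [hLD, AddSubgroup.mem_bot, neg_add_eq_zero] at hmem
    exact Subtype.ext hmem
  have h := addOrderOf_injective ((QuotientAddGroup.mk' D).comp L.subtype) hinj ⟨q, hq⟩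
  rw [AddMonoidHom.comp_apply, L.subtype_apply, AddSubgroup.addOrderOf_mk] at h
  exact h

/-- **`ord((d·u) • q) = ord q / d`** when `ord q = N`, `d ∣ N` and `u` is coprime to `N` (so `u • q`
still has order `N`, Mathlib `Nat.Coprime.addOrderOf_nsmul`). In (C): `loc_p κ_m(P) = (p^ν u) • κ_m(Q)`
with `ord κ_m(Q) = p^m`, `p ∤ u`, giving `ord = p^{m−ν}`. [folklore] -/
theorem addOrderOf_mul_nsmul_eq_div {q : H} {N d : ℕ} (hq : addOrderOf q = N) (hN : N ≠ 0)
    (hd : d ∣ N) {u : ℕ} (hu : N.Coprime u) : addOrderOf ((d * u) • q) = N / d := by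
  have hd0 : d ≠ 0 := by rintro rfl; exact hN (Nat.eq_zero_of_zero_dvd hd)
  have hu' : addOrderOf (u • q) = N := by
    rw [← hq] at hu ⊢
    exact hu.addOrderOf_nsmul
  rw [mul_nsmul', addOrderOf_nsmul_of_dvd hd0 (hu'.symm ▸ hd), hu']

end Orders

/-! ## §4 The prime-power numerology of (C) -/

section PrimePow

variable {R Q : Type*} [AddCommGroup R] [AddCommGroup Q] {p m : ℕ} {g : R} (φ : R →+ Q)
  {ι : Type*} {Q' : ι → Type*} [∀ i, AddCommGroup (Q' i)] (ψ : ∀ i, R →+ Q' i)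
  (D : ∀ i, AddSubgroup (Q' i))

/-- **B6 at finite level, prime-power form.** `p` prime; `p^m • R = 0`; `g` of order `p^m`;
`p^k • R ⊆ ℤg`; `ord(φ g) = p^{m−ν}`; `k ≤ t`, `t + ν ≤ m`; every `ψ_i` sends `R[p^t]` and
`p^{m−t−ν} • g` into `D_i`. Then **`[R : ker(p^t·φ) ⊓ ⨅_i ψ_i⁻¹(D_i)] = p^{m−t−ν}`** (`= p^{n−ν}`,
`n = m − t`). With `R = R_m = Sel^{rel@p}_{p^m}(W/ℚ)`, `g = κ_m(P)`, `φ = loc_p mod C_m^⊥`, `ψ_ℓ = loc_ℓ`,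
`D_ℓ = 𝒦_{m,ℓ}^⊥`: `[H¹_{𝓕^*}(ℚ, W[p^m]) : H¹_{𝓖^*}(ℚ, W[p^m])] = p^{n−ν}`, which with file 58 gives
`#(A₀ ⧸ S₀) = p^ν · ∏_ℓ #𝒦_{ℓ,0} = p^ν · Tam(W)^{(p)}`. [cite: GreenbergLNM1716, §4 (pp. 98–103)]
[cite: Kobayashi2003, Thm. 9.3 (p. 26)] -/
theorem index_eq_prime_pow (hp : p.Prime) (hR : ∀ x : R, p ^ m • x = 0)
    (hg : addOrderOf g = p ^ m) {k t ν : ℕ} (hk : ∀ x : R, p ^ k • x ∈ zmultiples g)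
    (hkt : k ≤ t) (htν : t + ν ≤ m) (hφ : addOrderOf (φ g) = p ^ (m - ν))
    (hψt : ∀ i, ∀ y : R, p ^ t • y = 0 → ψ i y ∈ D i)
    (hψg : ∀ i, ψ i (p ^ (m - t - ν) • g) ∈ D i) :
    ((p ^ t • φ).ker ⊓ ⨅ i, (D i).comap (ψ i)).index = p ^ (m - t - ν) := by
  have hpm : p ^ m ≠ 0 := pow_ne_zero m hp.ne_zero
  have hkt' : p ^ k ∣ p ^ t := pow_dvd_pow p hkt
  have htm : p ^ t ∣ p ^ m := pow_dvd_pow p (by omega)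
  have htφ : p ^ t ∣ addOrderOf (φ g) := by rw [hφ]; exact pow_dvd_pow p (by omega)
  have hc : addOrderOf (φ g) / p ^ t = p ^ (m - t - ν) := by
    rw [hφ, Nat.pow_div (by omega) hp.pos]
    congr 1
    omega
  rw [index_ker_nsmul_inf_iInf_comap_eq φ ψ D hpm hR hg hk hkt' htm htφ hψt (fun i => by
    rw [hc]; exact hψg i), hc]

/-- The same without further local conditions: **`[R : ker(p^t·φ)] = p^{m−t−ν}`**.
[cite: GreenbergLNM1716, §4 (pp. 98–103)] -/
theorem index_ker_eq_prime_pow (hp : p.Prime) (hR : ∀ x : R, p ^ m • x = 0)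
    (hg : addOrderOf g = p ^ m) {k t ν : ℕ} (hk : ∀ x : R, p ^ k • x ∈ zmultiples g)
    (hkt : k ≤ t) (htν : t + ν ≤ m) (hφ : addOrderOf (φ g) = p ^ (m - ν)) :
    (p ^ t • φ).ker.index = p ^ (m - t - ν) := by
  have hpm : p ^ m ≠ 0 := pow_ne_zero m hp.ne_zero
  have hkt' : p ^ k ∣ p ^ t := pow_dvd_pow p hkt
  have htm : p ^ t ∣ p ^ m := pow_dvd_pow p (by omega)
  have htφ : p ^ t ∣ addOrderOf (φ g) := by rw [hφ]; exact pow_dvd_pow p (by omega)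
  rw [index_ker_nsmul_eq φ hpm hR hg hk hkt' htm htφ, hφ, Nat.pow_div (by omega) hp.pos]
  congr 1
  omega

/-- **The input `p^k • R ⊆ ℤg` from two steps**: if `S ≤ R` (additive subgroups of an ambient group,
here phrased for `R` the whole group) has index dividing `p^a` and `p^e • S ⊆ ℤg`, then
`p^{a+e} • R ⊆ ℤg`. In (C): `S = Sel_{p^m}(W/ℚ) ≤ R_m`, `[R_m : Sel_{p^m}] ∣ p^ν` (exact relaxation
index at `p` against `#loc_p Sel_{p^m} ≥ p^{m−ν}`), `p^e Sel_{p^m} ⊆ ℤκ_m(P)` (`p^e Ш(W)[p^∞] = 0`).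
[cite: MilneADT2006, Ch. I §6, (6.14)] -/
theorem nsmul_mem_zmultiples_of_index_dvd (S : AddSubgroup R) {a e : ℕ} (hS : S.index ∣ p ^ a)
    (he : ∀ s ∈ S, p ^ e • s ∈ zmultiples g) (x : R) : p ^ (a + e) • x ∈ zmultiples g := by
  by_cases hpa : p ^ a = 0
  · rw [pow_add, hpa, zero_mul, zero_nsmul]; exact zero_mem _
  have hfin : S.index ≠ 0 := fun h => hpa (by rw [h, zero_dvd_iff] at hS; exact hS)
  haveI : S.FiniteIndex := ⟨hfin⟩
  have hx : S.index • x ∈ S := S.nsmul_index_mem x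
  obtain ⟨r, hr⟩ := hS
  have hxa : p ^ a • x ∈ S := by
    rw [hr, mul_comm, mul_nsmul']
    exact S.nsmul_mem hx r
  rw [pow_add, mul_comm, mul_nsmul']
  exact he _ hxa

end PrimePow

end StabilisedDual

end Summit.BirchSwinnertonDyer.Rank1Residual.Additive
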